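import Literature.Geometry.Lorentzian.CorrespondingBoundaryData
import Literature.Geometry.Lorentzian.CommonDevelopmentSymm
import Literature.Geometry.Lorentzian.HypersurfaceCorrespondingBoundary
import Literature.Geometry.Lorentzian.CauchyDevelopmentGlobalHyperbolicityProofs
import HarnessLib

/-!
# Boundary data at a spacelike corresponding boundary point of a common globally hyperbolic
# development (Sbierski 2016, §3.2, Lemmas 14–16 and the level set of `τ_q`), for the tree's
# Cauchy developments

The instance of `LorentzianMetric.exists_boundaryData_future` (`CorrespondingBoundaryData.lean`)
for a common globally hyperbolic development `(U, ψ)` of two Cauchy developments `𝒟`, `𝒟'` of the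
same data (`CauchyDevelopment.CommonDevelopment`), in both time directions: **if `U` has
corresponding boundary points, then at some boundary point `p₀ ∉ U` (to the future or to the past
of the data hypersurface) there are an open `W ∋ p₀`, a function `f`, `C^∞` on `W`, with
`f p₀ = 0`, differential positive on the future causal cone at `p₀` and zero set inside `Ū`, and a
map `Φ`, `C^∞` on `W`, agreeing with `ψ` on `W ∩ U`, with injective differential at `p₀`**
(`CauchyDevelopment.CommonDevelopment.exists_boundaryData_of_hasCorrespondingBoundaryPoints`) —
exactly the hypothesis `hbd` of
`Summit.FinalStateConjecture.FinalStateConjecture.Theorems.SubdataDevelopmentsEmbed.thm12_of_locallyUnique_of_boundaryData`,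
the LU-free half of Sbierski's Theorem 12.

The global-hyperbolicity inputs of the pure theorem are theorems over Cauchy developments
(`CauchyDevelopmentGlobalHyperbolicityProofs.lean`: strong causality, the causality condition,
compactness of `J∓(x) ∩ J±(ι X)`, closedness of `≤`); the transport of timelike curves along
`ψ` and `ψ⁻¹` is the chain rule with the isometry and time-orientation clauses of the common
development (`isFutureTimelikeCurveOn_glue_comp`, also for the reversed orientations); the past
case is the future case for the reversed time orientations of both developments.

Everything is proved; no definitions, no named facts (D-0026).

## References

* J. Sbierski, Ann. Henri Poincaré 17 (2016) 301–329 = arXiv:1309.7591v3, §3.2 (arXiv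
  numbering: Prop. 13, Lemmas 14–16, proof of Thm. 12). [Sbierski2016AHP]
* H. Ringström, *The Cauchy Problem in General Relativity*, EMS 2009, Ch. 23. [Ringstrom2009]
-/

noncomputable section

open Bundle Set Filter Function TopologicalSpace Topology
open scoped Manifold ContDiff Topology

namespace Literature.Geometry.Lorentzian

open Literature.Geometry.Riemannian

universe u

section Developments

variable {k : ℕ} {X : Type u} [TopologicalSpace X] [ChartedSpace (EuclideanSpace ℝ (Fin k)) X]
  [IsManifold (𝓡 k) ∞ X] [ConnectedSpace X] {D : InitialDataSet (𝓡 k) X}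

namespace CauchyDevelopment

namespace CommonDevelopment

variable {𝒟 𝒟' : CauchyDevelopment D} (𝔠 : CommonDevelopment 𝒟 𝒟')

/-! ### Transport of timelike curves along `ψ` -/

/-- The differential of the gluing map at a point of `U` preserves scalar products (`ψ` is an
isometric immersion of `g|_U`). [folklore] -/
theorem val_mfderiv_glue {y : 𝒟.carrier} (hy : y ∈ 𝔠.opens)
    (u w : TangentSpace (𝓡 (k + 1)) y) :
    𝒟'.metric.val (𝔠.glue y) (mfderiv (𝓡 (k + 1)) (𝓡 (k + 1)) 𝔠.glue y u)
      (mfderiv (𝓡 (k + 1)) (𝓡 (k + 1)) 𝔠.glue y w) = 𝒟.metric.val y u w := by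
  have h1 : mfderiv (𝓡 (k + 1)) (𝓡 (k + 1)) 𝔠.glue y = mfderiv (𝓡 (k + 1)) (𝓡 (k + 1)) 𝔠.map ⟨y, hy⟩ :=
    𝔠.mfderiv_glue_eq ⟨y, hy⟩
  have h2 := congrArg (fun b ↦ b u w) (𝔠.isIsometricImmersion.2 ⟨y, hy⟩)
  simp only [pullbackBilin_apply] at h2
  rw [h1, 𝔠.glue_apply hy]
  exact h2

/-- The differential of the gluing map at a point of `U` carries future-directed vectors to
future-directed vectors (`ψ` preserves the time orientations). [folklore] -/
theorem isFutureDirected_mfderiv_glue {y : 𝒟.carrier} (hy : y ∈ 𝔠.opens)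
    {v : TangentSpace (𝓡 (k + 1)) y} (hv : 𝒟.timeOrientation.IsFutureDirected v) :
    𝒟'.timeOrientation.IsFutureDirected (mfderiv (𝓡 (k + 1)) (𝓡 (k + 1)) 𝔠.glue y v) := by
  have h1 : mfderiv (𝓡 (k + 1)) (𝓡 (k + 1)) 𝔠.glue y = mfderiv (𝓡 (k + 1)) (𝓡 (k + 1)) 𝔠.map ⟨y, hy⟩ :=
    𝔠.mfderiv_glue_eq ⟨y, hy⟩
  have h := TimeOrientation.PreservesTimeOrientation.isFutureDirected_mfderiv 𝔠.preservesTimeOrientation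
    𝔠.isIsometricImmersion.2 (y := ⟨y, hy⟩) (v := v) hv
  rw [h1]
  convert h using 2 <;> first | exact (𝔠.glue_apply hy) | rfl

/-- **`ψ` carries future timelike curves of `U` to future timelike curves of `M'`.**
[cite: Sbierski2016AHP, §3.2, proof of Prop. 13 (arXiv numbering)] -/
theorem isFutureTimelikeCurveOn_glue_comp {γ : ℝ → 𝒟.carrier} {s : Set ℝ}
    (hγ : 𝒟.metric.IsFutureTimelikeCurveOn 𝒟.timeOrientation γ s) (hγU : ∀ t ∈ s, γ t ∈ 𝔠.opens) :
    𝒟'.metric.IsFutureTimelikeCurveOn 𝒟'.timeOrientation (𝔠.glue ∘ γ) s := by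
  intro t ht
  obtain ⟨hd, htl, hfd⟩ := hγ t ht
  have hψd : MDifferentiableAt (𝓡 (k + 1)) (𝓡 (k + 1)) 𝔠.glue (γ t) :=
    (𝔠.contMDiffOn_glue.contMDiffAt (by rw [glue_source]; exact 𝔠.opens.2.mem_nhds (hγU t ht))).mdifferentiableAt
      (by simp)
  have hvel : velocity (𝓡 (k + 1)) (𝔠.glue ∘ γ) t =
      mfderiv (𝓡 (k + 1)) (𝓡 (k + 1)) 𝔠.glue (γ t) (velocity (𝓡 (k + 1)) γ t) := by
    unfold velocity
    rw [mfderiv_comp t hψd hd]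
    rfl
  refine ⟨hψd.comp t hd, ?_, ?_⟩
  · show 𝒟'.metric.val (𝔠.glue (γ t)) (velocity (𝓡 (k + 1)) (𝔠.glue ∘ γ) t)
      (velocity (𝓡 (k + 1)) (𝔠.glue ∘ γ) t) < 0
    rw [hvel, 𝔠.val_mfderiv_glue (hγU t ht)]
    exact htl
  · rw [hvel]
    exact 𝔠.isFutureDirected_mfderiv_glue (hγU t ht) hfd

/-- **`ψ` carries timelike curves of `U` which are future for the REVERSED time orientation to
timelike curves of `M'` which are future for the reversed time orientation** (i.e. past timelike
curves to past timelike curves). [folklore] -/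
theorem isFutureTimelikeCurveOn_glue_comp_reverse {γ : ℝ → 𝒟.carrier} {s : Set ℝ}
    (hγ : 𝒟.metric.IsFutureTimelikeCurveOn 𝒟.timeOrientation.reverse γ s)
    (hγU : ∀ t ∈ s, γ t ∈ 𝔠.opens) :
    𝒟'.metric.IsFutureTimelikeCurveOn 𝒟'.timeOrientation.reverse (𝔠.glue ∘ γ) s := by
  intro t ht
  obtain ⟨hd, htl, hfd⟩ := hγ t ht
  have hψd : MDifferentiableAt (𝓡 (k + 1)) (𝓡 (k + 1)) 𝔠.glue (γ t) :=
    (𝔠.contMDiffOn_glue.contMDiffAt (by rw [glue_source]; exact 𝔠.opens.2.mem_nhds (hγU t ht))).mdifferentiableAt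
      (by simp)
  have hvel : velocity (𝓡 (k + 1)) (𝔠.glue ∘ γ) t =
      mfderiv (𝓡 (k + 1)) (𝓡 (k + 1)) 𝔠.glue (γ t) (velocity (𝓡 (k + 1)) γ t) := by
    unfold velocity
    rw [mfderiv_comp t hψd hd]
    rfl
  refine ⟨hψd.comp t hd, ?_, ?_⟩
  · show 𝒟'.metric.val (𝔠.glue (γ t)) (velocity (𝓡 (k + 1)) (𝔠.glue ∘ γ) t)
      (velocity (𝓡 (k + 1)) (𝔠.glue ∘ γ) t) < 0
    rw [hvel, 𝔠.val_mfderiv_glue (hγU t ht)]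
    exact htl
  · have hfd' : 𝒟.timeOrientation.IsFutureDirected (-velocity (𝓡 (k + 1)) γ t) := by
      rw [TimeOrientation.isFutureDirected_neg_iff, ← TimeOrientation.isFutureDirected_reverse_iff]
      exact hfd
    have h := 𝔠.isFutureDirected_mfderiv_glue (hγU t ht) hfd'
    have h' : 𝒟'.timeOrientation.IsFutureDirected (x := 𝔠.glue (γ t))
        (-(mfderiv (𝓡 (k + 1)) (𝓡 (k + 1)) 𝔠.glue (γ t) (velocity (𝓡 (k + 1)) γ t))) := by
      rw [← map_neg]; exact h
    rw [hvel]
    show 𝒟'.timeOrientation.reverse.IsFutureDirected (x := 𝔠.glue (γ t))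
      (mfderiv (𝓡 (k + 1)) (𝓡 (k + 1)) 𝔠.glue (γ t) (velocity (𝓡 (k + 1)) γ t))
    rw [TimeOrientation.isFutureDirected_reverse_iff, ← TimeOrientation.isFutureDirected_neg_iff]
    exact h'

/-! ### The boundary data, future case -/

/-- **Boundary data at a spacelike corresponding boundary point of a common development, for a
corresponding pair to the future of the data hypersurface** (instance of
`LorentzianMetric.exists_boundaryData_future`; global-hyperbolicity inputs discharged by the
theorems of `CauchyDevelopmentGlobalHyperbolicityProofs.lean`, transport by
`isFutureTimelikeCurveOn_glue_comp` for `𝔠` and `𝔠.symm`).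
[cite: Sbierski2016AHP, §3.2, proof of Thm. 12 with Prop. 13 and Lemmas 14–16 (arXiv numbering)] -/
theorem exists_boundaryData_future {p : 𝒟.carrier} {p' : 𝒟'.carrier} (h : 𝔠.IsCorrespondingPair p p')
    (hpI : p ∈ 𝒟.metric.chronologicalFuture 𝒟.timeOrientation (range 𝒟.embed)) :
    ∃ (p₀ : 𝒟.carrier) (W : Set 𝒟.carrier) (f : 𝒟.carrier → ℝ) (Φ : 𝒟.carrier → 𝒟'.carrier),
      p₀ ∉ 𝔠.opens ∧ p₀ ∈ 𝒟.metric.chronologicalFuture 𝒟.timeOrientation (range 𝒟.embed) ∧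
      IsOpen W ∧ p₀ ∈ W ∧ ContMDiffOn (𝓡 (k + 1)) 𝓘(ℝ, ℝ) ∞ f W ∧ f p₀ = 0 ∧
      (∀ v : TangentSpace (𝓡 (k + 1)) p₀, 𝒟.timeOrientation.IsFutureDirected v →
        (0 : ℝ) < mfderiv (𝓡 (k + 1)) 𝓘(ℝ, ℝ) f p₀ v) ∧
      (∀ q ∈ W, f q = 0 → q ∈ closure (𝔠.opens : Set 𝒟.carrier)) ∧
      ContMDiffOn (𝓡 (k + 1)) (𝓡 (k + 1)) ∞ Φ W ∧
      (∀ (q : 𝒟.carrier) (hq : q ∈ 𝔠.opens), q ∈ W → Φ q = 𝔠.map ⟨q, hq⟩) ∧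
      Injective (mfderiv (𝓡 (k + 1)) (𝓡 (k + 1)) Φ p₀) := by
  have hk : ((1 : ℕ∞) : ℕ∞ω) + 1 ≤ ∞ := by
    rw [show ((1 : ℕ∞) : ℕ∞ω) + 1 = 2 by norm_num]
    exact WithTop.coe_le_coe.2 le_top
  haveI : Fact ((1 : ℕ∞ω) ≤ ∞) := ⟨by exact_mod_cast (le_top : (1 : ℕ∞) ≤ ⊤)⟩
  -- Levi-Civita connections of `g`, `g|_U`, `g'`, and their smoothness
  haveI := 𝒟.metric.toPseudoRiemannianMetric.hasLeviCivita
  haveI : CovariantDerivative.ContMDiffCovariantDerivative 𝒟.metric.leviCivita 1 :=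
    ⟨𝒟.metric.toPseudoRiemannianMetric.isLocallyContMDiff_leviCivita_holds 1 hk univ isOpen_univ⟩
  haveI := (𝒟.metric.toPseudoRiemannianMetric.restrict PseudoRiemannianMetric.contMDiff_restrict_holds
    𝔠.opens).hasLeviCivita
  haveI : CovariantDerivative.ContMDiffCovariantDerivative
      (𝒟.metric.toPseudoRiemannianMetric.restrict PseudoRiemannianMetric.contMDiff_restrict_holds
        𝔠.opens).leviCivita 1 :=
    ⟨(𝒟.metric.toPseudoRiemannianMetric.restrict PseudoRiemannianMetric.contMDiff_restrict_holds
      𝔠.opens).isLocallyContMDiff_leviCivita_holds 1 hk univ isOpen_univ⟩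
  haveI := 𝒟'.metric.toPseudoRiemannianMetric.hasLeviCivita
  haveI : CovariantDerivative.ContMDiffCovariantDerivative 𝒟'.metric.leviCivita 1 :=
    ⟨𝒟'.metric.toPseudoRiemannianMetric.isLocallyContMDiff_leviCivita_holds 1 hk univ isOpen_univ⟩
  -- the inverse `φ = ψ⁻¹` as a total map, and the bookkeeping between `U` and `ψ(U)`
  have hΨW : MapsTo 𝔠.glue 𝔠.opens 𝔠.rangeOpens := fun y hy ↦ by
    show 𝔠.glue y ∈ range 𝔠.map
    rw [𝔠.glue_apply hy]; exact ⟨_, rfl⟩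
  have hφU : MapsTo 𝔠.symm.glue 𝔠.rangeOpens 𝔠.opens := fun z hz ↦ by
    show 𝔠.symm.glue z ∈ 𝔠.opens
    rw [𝔠.symm.glue_apply (show z ∈ 𝔠.symm.opens from hz), symm_map, symmMap_apply]
    exact 𝔠.glue_symm_mem_opens hz
  have hφΨ : ∀ y ∈ (𝔠.opens : Set 𝒟.carrier), 𝔠.symm.glue (𝔠.glue y) = y := by
    intro y hy
    have hgy : 𝔠.glue y = 𝔠.map ⟨y, hy⟩ := 𝔠.glue_apply hy
    have hz : 𝔠.map ⟨y, hy⟩ ∈ 𝔠.symm.opens := ⟨⟨y, hy⟩, rfl⟩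
    rw [hgy, 𝔠.symm.glue_apply hz, symm_map, symmMap_apply]
    exact 𝔠.glue_symm_apply_map ⟨y, hy⟩
  have hΨφ : ∀ z ∈ (𝔠.rangeOpens : Set 𝒟'.carrier), 𝔠.glue (𝔠.symm.glue z) = z := by
    intro z hz
    rw [𝔠.symm.glue_apply (show z ∈ 𝔠.symm.opens from hz), symm_map, symmMap_apply]
    exact 𝔠.glue.right_inv (by rw [glue_target]; exact hz)
  have hΨS : 𝔠.glue '' range 𝒟.embed ⊆ range 𝒟'.embed := by
    rintro _ ⟨_, ⟨x, rfl⟩, rfl⟩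
    refine ⟨x, ?_⟩
    rw [𝔠.glue_apply (𝔠.embed_mem x)]
    exact (𝔠.map_embedOpens x).symm
  have hSigU : range 𝒟.embed ⊆ (𝔠.opens : Set 𝒟.carrier) := by
    rintro _ ⟨x, rfl⟩; exact 𝔠.embed_mem x
  have hcorr : ∀ V ∈ 𝓝 p, ∀ V' ∈ 𝓝 p', ∃ y ∈ (𝔠.opens : Set 𝒟.carrier), y ∈ V ∧ 𝔠.glue y ∈ V' := by
    intro V hV V' hV'
    obtain ⟨y, hyV, hyV'⟩ := h.2.2 V hV V' hV'
    exact ⟨y.1, y.2, hyV, by rw [𝔠.glue_apply y.2]; exact hyV'⟩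
  obtain ⟨p₀, W, f, Φ, hp₀U, hp₀I, hWo, hp₀W, hfs, hf0, hdf, hlevel, hΦs, hΦψ, hΦinj⟩ :=
    LorentzianMetric.exists_boundaryData_future 𝒟.timeOrientation 𝒟'.timeOrientation 𝔠.opens
      𝒟.isCauchyHypersurface hSigU 𝔠.isCauchyHypersurface 𝒟'.isCauchyHypersurface
      𝔠.isCauchyHypersurface_rangeOpens 𝒟.isStronglyCausal 𝒟'.isStronglyCausal 𝒟.isGloballyHyperbolic.1
      𝒟.isCompact_causalPast_inter_causalFuture_range 𝒟'.isCompact_causalPast_inter_causalFuture_range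
      (fun hx hy hxy ↦ 𝒟.mem_causalFuture_of_tendsto hx hy hxy)
      (fun hx hy hxy ↦ 𝒟'.mem_causalFuture_of_tendsto hx hy hxy) 𝒟.isClosed_causalPast_singleton
      𝔠.isIsometricImmersion (Ψ := 𝔠.glue) (fun q hq ↦ 𝔠.glue_apply hq)
      (fun γ s hγ hγU ↦ 𝔠.isFutureTimelikeCurveOn_glue_comp hγ hγU) hΨW hΨS hφU hφΨ hΨφ
      (fun γ s hγ hγW ↦ 𝔠.symm.isFutureTimelikeCurveOn_glue_comp hγ hγW) h.1 hpI hcorr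
  exact ⟨p₀, W, f, Φ, hp₀U, hp₀I, hWo, hp₀W, hfs, hf0, hdf, hlevel, hΦs,
    fun q hq hqW ↦ hΦψ q hqW hq, hΦinj⟩

/-! ### The past case by time reversal, and the two cases together -/

/-- **Boundary data for a corresponding pair to the PAST of the data hypersurface**: the future
case for the reversed time orientations of `𝒟` and `𝒟'` (Cauchy hypersurfaces, strong causality,
the causality condition, isometries and the correspondence are self-dual; `I⁻`, `J⁻` for `τ` are
`I⁺`, `J⁺` for `-τ`; the output function is negated). Sbierski 2016, §3.2 ("otherwise we reverse
the time orientation"). [cite: Sbierski2016AHP, §3.2, remark after Lemma 15 and proof of Thm. 12 (arXiv numbering)] -/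
theorem exists_boundaryData_past {p : 𝒟.carrier} {p' : 𝒟'.carrier} (h : 𝔠.IsCorrespondingPair p p')
    (hpI : p ∈ 𝒟.metric.chronologicalPast 𝒟.timeOrientation (range 𝒟.embed)) :
    ∃ (p₀ : 𝒟.carrier) (W : Set 𝒟.carrier) (f : 𝒟.carrier → ℝ) (Φ : 𝒟.carrier → 𝒟'.carrier),
      p₀ ∉ 𝔠.opens ∧ p₀ ∈ 𝒟.metric.chronologicalPast 𝒟.timeOrientation (range 𝒟.embed) ∧
      IsOpen W ∧ p₀ ∈ W ∧ ContMDiffOn (𝓡 (k + 1)) 𝓘(ℝ, ℝ) ∞ f W ∧ f p₀ = 0 ∧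
      (∀ v : TangentSpace (𝓡 (k + 1)) p₀, 𝒟.timeOrientation.IsFutureDirected v →
        (0 : ℝ) < mfderiv (𝓡 (k + 1)) 𝓘(ℝ, ℝ) f p₀ v) ∧
      (∀ q ∈ W, f q = 0 → q ∈ closure (𝔠.opens : Set 𝒟.carrier)) ∧
      ContMDiffOn (𝓡 (k + 1)) (𝓡 (k + 1)) ∞ Φ W ∧
      (∀ (q : 𝒟.carrier) (hq : q ∈ 𝔠.opens), q ∈ W → Φ q = 𝔠.map ⟨q, hq⟩) ∧
      Injective (mfderiv (𝓡 (k + 1)) (𝓡 (k + 1)) Φ p₀) := by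
  have hk : ((1 : ℕ∞) : ℕ∞ω) + 1 ≤ ∞ := by
    rw [show ((1 : ℕ∞) : ℕ∞ω) + 1 = 2 by norm_num]
    exact WithTop.coe_le_coe.2 le_top
  haveI : Fact ((1 : ℕ∞ω) ≤ ∞) := ⟨by exact_mod_cast (le_top : (1 : ℕ∞) ≤ ⊤)⟩
  haveI := 𝒟.metric.toPseudoRiemannianMetric.hasLeviCivita
  haveI : CovariantDerivative.ContMDiffCovariantDerivative 𝒟.metric.leviCivita 1 :=
    ⟨𝒟.metric.toPseudoRiemannianMetric.isLocallyContMDiff_leviCivita_holds 1 hk univ isOpen_univ⟩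
  haveI := (𝒟.metric.toPseudoRiemannianMetric.restrict PseudoRiemannianMetric.contMDiff_restrict_holds
    𝔠.opens).hasLeviCivita
  haveI : CovariantDerivative.ContMDiffCovariantDerivative
      (𝒟.metric.toPseudoRiemannianMetric.restrict PseudoRiemannianMetric.contMDiff_restrict_holds
        𝔠.opens).leviCivita 1 :=
    ⟨(𝒟.metric.toPseudoRiemannianMetric.restrict PseudoRiemannianMetric.contMDiff_restrict_holds
      𝔠.opens).isLocallyContMDiff_leviCivita_holds 1 hk univ isOpen_univ⟩
  haveI := 𝒟'.metric.toPseudoRiemannianMetric.hasLeviCivita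
  haveI : CovariantDerivative.ContMDiffCovariantDerivative 𝒟'.metric.leviCivita 1 :=
    ⟨𝒟'.metric.toPseudoRiemannianMetric.isLocallyContMDiff_leviCivita_holds 1 hk univ isOpen_univ⟩
  set τ := 𝒟.timeOrientation with hτ_def
  set τ' := 𝒟'.timeOrientation with hτ'_def
  -- bookkeeping between `U` and `ψ(U)` (as in the future case)
  have hΨW : MapsTo 𝔠.glue 𝔠.opens 𝔠.rangeOpens := fun y hy ↦ by
    show 𝔠.glue y ∈ range 𝔠.map
    rw [𝔠.glue_apply hy]; exact ⟨_, rfl⟩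
  have hφU : MapsTo 𝔠.symm.glue 𝔠.rangeOpens 𝔠.opens := fun z hz ↦ by
    show 𝔠.symm.glue z ∈ 𝔠.opens
    rw [𝔠.symm.glue_apply (show z ∈ 𝔠.symm.opens from hz), symm_map, symmMap_apply]
    exact 𝔠.glue_symm_mem_opens hz
  have hφΨ : ∀ y ∈ (𝔠.opens : Set 𝒟.carrier), 𝔠.symm.glue (𝔠.glue y) = y := by
    intro y hy
    have hgy : 𝔠.glue y = 𝔠.map ⟨y, hy⟩ := 𝔠.glue_apply hy
    have hz : 𝔠.map ⟨y, hy⟩ ∈ 𝔠.symm.opens := ⟨⟨y, hy⟩, rfl⟩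
    rw [hgy, 𝔠.symm.glue_apply hz, symm_map, symmMap_apply]
    exact 𝔠.glue_symm_apply_map ⟨y, hy⟩
  have hΨφ : ∀ z ∈ (𝔠.rangeOpens : Set 𝒟'.carrier), 𝔠.glue (𝔠.symm.glue z) = z := by
    intro z hz
    rw [𝔠.symm.glue_apply (show z ∈ 𝔠.symm.opens from hz), symm_map, symmMap_apply]
    exact 𝔠.glue.right_inv (by rw [glue_target]; exact hz)
  have hΨS : 𝔠.glue '' range 𝒟.embed ⊆ range 𝒟'.embed := by
    rintro _ ⟨_, ⟨x, rfl⟩, rfl⟩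
    refine ⟨x, ?_⟩
    rw [𝔠.glue_apply (𝔠.embed_mem x)]
    exact (𝔠.map_embedOpens x).symm
  have hSigU : range 𝒟.embed ⊆ (𝔠.opens : Set 𝒟.carrier) := by
    rintro _ ⟨x, rfl⟩; exact 𝔠.embed_mem x
  have hcorr : ∀ V ∈ 𝓝 p, ∀ V' ∈ 𝓝 p', ∃ y ∈ (𝔠.opens : Set 𝒟.carrier), y ∈ V ∧ 𝔠.glue y ∈ V' := by
    intro V hV V' hV'
    obtain ⟨y, hyV, hyV'⟩ := h.2.2 V hV V' hV'
    exact ⟨y.1, y.2, hyV, by rw [𝔠.glue_apply y.2]; exact hyV'⟩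
  -- the hypotheses of the pure theorem for the reversed orientations
  have hSig : 𝒟.metric.IsCauchyHypersurface τ.reverse (range 𝒟.embed) := 𝒟.isCauchyHypersurface.reverse
  have hU : (𝒟.metric.restrict PseudoRiemannianMetric.contMDiff_restrict_holds 𝔠.opens).IsCauchyHypersurface
      (τ.reverse.restrict PseudoRiemannianMetric.contMDiff_restrict_holds
        (τ.contMDiff_restrict_reverse τ.contMDiff_restrict_holds) 𝔠.opens)
      (Subtype.val ⁻¹' range 𝒟.embed) := by
    have h1 := 𝔠.isCauchyHypersurface.reverse
    rw [TimeOrientation.restrict_reverse] at h1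
    exact h1
  have hSig' : 𝒟'.metric.IsCauchyHypersurface τ'.reverse (range 𝒟'.embed) := 𝒟'.isCauchyHypersurface.reverse
  have hW' : (𝒟'.metric.restrict PseudoRiemannianMetric.contMDiff_restrict_holds 𝔠.rangeOpens).IsCauchyHypersurface
      (τ'.reverse.restrict PseudoRiemannianMetric.contMDiff_restrict_holds
        (τ'.contMDiff_restrict_reverse τ'.contMDiff_restrict_holds) 𝔠.rangeOpens)
      (Subtype.val ⁻¹' range 𝒟'.embed) := by
    have h1 := 𝔠.isCauchyHypersurface_rangeOpens.reverse
    rw [TimeOrientation.restrict_reverse] at h1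
    exact h1
  have hK₁ : ∀ x : 𝒟.carrier, IsCompact (𝒟.metric.causalPast τ.reverse {x} ∩
      𝒟.metric.causalFuture τ.reverse (range 𝒟.embed)) := fun x ↦ by
    rw [LorentzianMetric.causalPast_reverse]
    exact 𝒟.isCompact_causalFuture_inter_causalPast_range x
  have hK₂ : ∀ x' : 𝒟'.carrier, IsCompact (𝒟'.metric.causalPast τ'.reverse {x'} ∩
      𝒟'.metric.causalFuture τ'.reverse (range 𝒟'.embed)) := fun x' ↦ by
    rw [LorentzianMetric.causalPast_reverse]
    exact 𝒟'.isCompact_causalFuture_inter_causalPast_range x'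
  have hrel₁ : ∀ {xs ys : ℕ → 𝒟.carrier} {x y : 𝒟.carrier}, Tendsto xs atTop (𝓝 x) →
      Tendsto ys atTop (𝓝 y) → (∀ j, ys j ∈ 𝒟.metric.causalFuture τ.reverse {xs j}) →
      y ∈ 𝒟.metric.causalFuture τ.reverse {x} := by
    intro xs ys x y hx hy hxy
    show y ∈ 𝒟.metric.causalPast τ {x}
    exact LorentzianMetric.mem_causalPast_singleton_iff.2 (𝒟.mem_causalFuture_of_tendsto hy hx fun j ↦
      LorentzianMetric.mem_causalPast_singleton_iff.1 (hxy j))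
  have hrel₂ : ∀ {xs ys : ℕ → 𝒟'.carrier} {x y : 𝒟'.carrier}, Tendsto xs atTop (𝓝 x) →
      Tendsto ys atTop (𝓝 y) → (∀ j, ys j ∈ 𝒟'.metric.causalFuture τ'.reverse {xs j}) →
      y ∈ 𝒟'.metric.causalFuture τ'.reverse {x} := by
    intro xs ys x y hx hy hxy
    show y ∈ 𝒟'.metric.causalPast τ' {x}
    exact LorentzianMetric.mem_causalPast_singleton_iff.2 (𝒟'.mem_causalFuture_of_tendsto hy hx fun j ↦
      LorentzianMetric.mem_causalPast_singleton_iff.1 (hxy j))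
  have hJ₁ : ∀ x : 𝒟.carrier, IsClosed (𝒟.metric.causalPast τ.reverse {x}) := fun x ↦ by
    rw [LorentzianMetric.causalPast_reverse]
    exact 𝒟.isClosed_causalFuture_singleton x
  obtain ⟨p₀, W, f, Φ, hp₀U, hp₀I, hWo, hp₀W, hfs, hf0, hdf, hlevel, hΦs, hΦψ, hΦinj⟩ :=
    LorentzianMetric.exists_boundaryData_future τ.reverse τ'.reverse 𝔠.opens hSig hSigU hU hSig' hW'
      𝒟.isStronglyCausal.reverse 𝒟'.isStronglyCausal.reverse 𝒟.isGloballyHyperbolic.1.reverse hK₁ hK₂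
      hrel₁ hrel₂ hJ₁ 𝔠.isIsometricImmersion (Ψ := 𝔠.glue) (fun q hq ↦ 𝔠.glue_apply hq)
      (fun γ s hγ hγU ↦ 𝔠.isFutureTimelikeCurveOn_glue_comp_reverse hγ hγU) hΨW hΨS hφU hφΨ hΨφ
      (fun γ s hγ hγW ↦ 𝔠.symm.isFutureTimelikeCurveOn_glue_comp_reverse hγ hγW) h.1 hpI hcorr
  refine ⟨p₀, W, fun r ↦ -f r, Φ, hp₀U, hp₀I, hWo, hp₀W, hfs.neg, by show -f p₀ = 0; rw [hf0, neg_zero], ?_,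
    fun q hq hfq ↦ hlevel q hq (neg_eq_zero.1 hfq), hΦs, fun q hq hqW ↦ hΦψ q hqW hq, hΦinj⟩
  intro v hv
  have hv' : τ.reverse.IsFutureDirected (-v) := by
    rw [TimeOrientation.isFutureDirected_reverse_iff, ← TimeOrientation.isFutureDirected_neg_iff, neg_neg]
    exact hv
  have h1 := hdf (-v) hv'
  have h2 : mfderiv (𝓡 (k + 1)) 𝓘(ℝ, ℝ) (fun r ↦ -f r) p₀ = -mfderiv (𝓡 (k + 1)) 𝓘(ℝ, ℝ) f p₀ :=
    mfderiv_neg (f := f) (x := p₀)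
  have h3 : (mfderiv (𝓡 (k + 1)) 𝓘(ℝ, ℝ) (fun r ↦ -f r) p₀ v : ℝ) =
      -(mfderiv (𝓡 (k + 1)) 𝓘(ℝ, ℝ) f p₀ v : ℝ) := DFunLike.congr_fun h2 v
  have h5 : (mfderiv (𝓡 (k + 1)) 𝓘(ℝ, ℝ) f p₀ (-v) : ℝ) = -(mfderiv (𝓡 (k + 1)) 𝓘(ℝ, ℝ) f p₀ v : ℝ) :=
    map_neg _ v
  have h6 : (0 : ℝ) < -(mfderiv (𝓡 (k + 1)) 𝓘(ℝ, ℝ) f p₀ v : ℝ) := by rw [← h5]; exact h1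
  exact lt_of_lt_of_eq h6 h3.symm

/-- **Boundary data at a spacelike corresponding boundary point of a common globally hyperbolic
development** (both time directions): if `U` has corresponding boundary points, then at some
`p₀ ∉ U`, to the future or to the past of `ι(X)`, there are `W`, `f`, `Φ` with the properties
(H1)–(H4) of the module docstring — the hypothesis `hbd` of the restart of the local uniqueness
theorem. [cite: Sbierski2016AHP, §3.2, proof of Thm. 12 with Prop. 13 and Lemmas 14–16 (arXiv numbering)] -/
theorem exists_boundaryData_of_hasCorrespondingBoundaryPoints (h : 𝔠.HasCorrespondingBoundaryPoints) :
    ∃ (p₀ : 𝒟.carrier) (W : Set 𝒟.carrier) (f : 𝒟.carrier → ℝ) (Φ : 𝒟.carrier → 𝒟'.carrier),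
      p₀ ∉ 𝔠.opens ∧
      (p₀ ∈ 𝒟.metric.chronologicalFuture 𝒟.timeOrientation (range 𝒟.embed) ∨
        p₀ ∈ 𝒟.metric.chronologicalPast 𝒟.timeOrientation (range 𝒟.embed)) ∧
      IsOpen W ∧ p₀ ∈ W ∧ ContMDiffOn (𝓡 (k + 1)) 𝓘(ℝ, ℝ) ∞ f W ∧ f p₀ = 0 ∧
      (∀ v : TangentSpace (𝓡 (k + 1)) p₀, 𝒟.timeOrientation.IsFutureDirected v →
        (0 : ℝ) < mfderiv (𝓡 (k + 1)) 𝓘(ℝ, ℝ) f p₀ v) ∧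
      (∀ q ∈ W, f q = 0 → q ∈ closure (𝔠.opens : Set 𝒟.carrier)) ∧
      ContMDiffOn (𝓡 (k + 1)) (𝓡 (k + 1)) ∞ Φ W ∧
      (∀ (q : 𝒟.carrier) (hq : q ∈ 𝔠.opens), q ∈ W → Φ q = 𝔠.map ⟨q, hq⟩) ∧
      Injective (mfderiv (𝓡 (k + 1)) (𝓡 (k + 1)) Φ p₀) := by
  have hn2 : (2 : ℕ∞ω) ≤ ∞ := WithTop.coe_le_coe.mpr le_top
  obtain ⟨p, p', hpair⟩ := h
  have hpU : p ∉ 𝔠.opens := fun hp ↦ by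
    have h' : p ∉ interior (𝔠.opens : Set 𝒟.carrier) := hpair.1.2
    rw [𝔠.opens.isOpen.interior_eq] at h'
    exact h' hp
  have hpS : p ∉ range 𝒟.embed := fun ⟨x, hx⟩ ↦ hpU (hx ▸ 𝔠.embed_mem x)
  rcases 𝒟.isCauchyHypersurface.mem_chronologicalFuture_union_chronologicalPast hn2 hpS with hpI | hpI
  · obtain ⟨p₀, W, f, Φ, h1, h2, hrest⟩ := 𝔠.exists_boundaryData_future hpair hpI
    exact ⟨p₀, W, f, Φ, h1, Or.inl h2, hrest⟩
  · obtain ⟨p₀, W, f, Φ, h1, h2, hrest⟩ := 𝔠.exists_boundaryData_past hpair hpI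
    exact ⟨p₀, W, f, Φ, h1, Or.inr h2, hrest⟩

end CommonDevelopment

end CauchyDevelopment

end Developments

end Literature.Geometry.Lorentzian

end
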